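import Literature.AlgebraicGeometry.Frobenioids.PiNatMonoid
import Literature.AlgebraicGeometry.Frobenioids.PerfFactorial
import Literature.AlgebraicGeometry.Frobenioids.MonoidRealification
import Literature.AlgebraicGeometry.Frobenioids.Factorization
import HarnessLib

/-!
# [FrdI] Def. 2.4 (i) for `∏_J ℤ≥0`, continued: the factorization homomorphism COMPUTED, clauses (c),
# and the repaired clause (d♮) "integral patterns" (finding F-L2d2-1)

Mochizuki, *The geometry of Frobenioids I*, Kyushu J. Math. **62** (2008), Def. 2.4 (i), kurims p.47
[cite: MochizukiFrdI2008, Def. 2.4(i) p.47]: "(c) The map `M^pf → M^rlf_factor := ∏_𝔭 M^rlf_𝔭`,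
`a ↦ (…, sup(Bound_{𝔭 ∪ {0}}(a)), …)` … is a well-defined [i.e., the various `Bound_{𝔭 ∪ {0}}(a) ⊆ M^rlf_𝔭`
are bounded subsets] injective homomorphism of monoids whose image lies in `∏_𝔭 M^pf_𝔭`"; "(d) If
`a ∈ M^pf_factor` and `b ∈ M^pf` satisfy `Supp(a) ⊆ Supp(b)`, then `a ∈ M^pf`."

abc-iut cell, finding F-L2d2-1 (seat abc-iut-L2-d2; kernel witness `PerfFactorialProductCounterexample.lean`:
clause (d) FAILS for `∏_ℕ ℤ≥0`).  THIS FILE (sequel of `PiNatMonoid.lean`) establishes, for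
`M_J := Multiplicative (J → ℕ)` = `∏_J ℤ≥0` — the shape of `DIV⁺(Z_∞^log)` over the irreducible components of
an infinite special fibre, [EtTh] Prop. 3.2 (i) [cite: MochizukiEtTh2009, Prop 3.2 p.70] — everything of
Def. 2.4 (i) EXCEPT printed (d): the primes of `M_J^pf` are the `𝔮_j` (`q`), the elements of `(M_J^pf)_{𝔮_j}`
are the roots `(e_j^k)^{1/n}`, the factorization homomorphism is COMPUTED
(`factorMap_apply`: the `𝔮_j`-component of `f^{1/n}` is `(e_j^{f_j})^{1/n} ⊗ 1`), whence (c): bounded,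
`factorMap 1 = 1`, multiplicative, injective, image in `∏ M^pf_𝔮`; and the REPAIRED clause (d♮) proposed
in F-L2d2-1 holds in the strongest form — EVERY family of integral components `(e_j^{k_j})_j` is the
factorization of an element of `M_J` (`exists_factorMap_eq_of_integral`), as do the printed bracket
"[`a ≤ b` in `M^pf` iff in `M^pf_factor`]" (`dvd_of_factorMap_dvd`) and restriction to sub-supports
(`exists_factorMap_restrict`).  Packaging as the weak perf-factorial structure of abc-iut-L1-t2 follows its
landing.  HONEST FRAMING: classical monoid algebra; nothing here bears on [IUTchIII] Cor. 3.12.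
-/

noncomputable section

namespace Literature.AlgebraicGeometry.Frobenioids

namespace PiNat

open Function Literature.AnabelianGeometry.EtaleTheta

universe u

variable {J : Type u} [DecidableEq J]

/-! ### The coordinate projections `π_j : f ↦ e_j^{f_j}` and their perfections -/

/-- The coordinate projection `π_j : ∏_J ℤ≥0 → ∏_J ℤ≥0`, `f ↦ e_j^{f_j}`, a monoid endomorphism.
[cite: MochizukiFrdI2008, §0 p.12] -/
def proj (j : J) : Multiplicative (J → ℕ) →* Multiplicative (J → ℕ) where
  toFun f := single j (coeff f j)
  map_one' := by rw [coeff_one, single_zero]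
  map_mul' f g := by rw [coeff_mul, single_mul_single]

/-- `π_j f = e_j^{f_j}`. [cite: MochizukiFrdI2008, §0 p.12] -/
@[simp] theorem proj_apply (j : J) (f : Multiplicative (J → ℕ)) : proj j f = single j (coeff f j) := rfl

/-- `π_j` fixes the `e_j^k`. [cite: MochizukiFrdI2008, §0 p.12] -/
@[simp] theorem proj_single (j : J) (k : ℕ) : proj j (single j k) = single j k := by
  rw [proj_apply, coeff_single_same]

/-- `π_j f ≤ f`. [cite: MochizukiFrdI2008, §0 p.12] -/
theorem proj_dvd (j : J) (f : Multiplicative (J → ℕ)) : proj j f ∣ f :=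
  dvd_iff.2 fun i => by
    by_cases hi : i = j
    · subst hi; simp
    · rw [proj_apply, coeff_single_of_ne hi]; exact Nat.zero_le _

omit [DecidableEq J] in
/-- `Perfection.mk · n` is multiplicative. [cite: MochizukiFrdI2008, §0 p.11] -/
theorem mk_mul (a b : Multiplicative (J → ℕ)) (n : ℕ+) :
    Perfection.mk (a * b) n = Perfection.mk a n * Perfection.mk b n := by
  rw [Perfection.mk_mul_mk, ← mul_pow, ← Perfection.mk_pow_mul (a * b) n n]

/-! ### The primes `𝔮_j` of `M^pf` and the submonoids `M^pf_{𝔮_j}` -/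

/-- The prime `𝔮_j` of `M_J^pf` corresponding to the coordinate `j` (`Prime(M) ≃ Prime(M^pf)`, §0 p.12).
[cite: MochizukiFrdI2008, §0 p.12] -/
def q (j : J) : Primes (Perfection (Multiplicative (J → ℕ))) := Primes.perfectionEquiv isSharp (prime j)

/-- `j ↦ 𝔮_j` is a bijection `J ≃ Prime(M_J^pf)`. [cite: MochizukiFrdI2008, §0 p.12] -/
theorem q_bijective : Bijective (q (J := J)) :=
  (Primes.perfectionEquiv isSharp).bijective.comp prime_bijective

/-- The elements of `𝔮_j` are the roots `(e_j^k)^{1/n}`, `k ≠ 0`. [cite: MochizukiFrdI2008, §0 p.12] -/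
theorem mk_mem_carrier_q_iff {j : J} {f : Multiplicative (J → ℕ)} {n : ℕ+} :
    Perfection.mk f n ∈ (q j).carrier ↔ ∃ k, k ≠ 0 ∧ f = single j k := by
  rw [q, Primes.mk_mem_carrier_perfectionEquiv_iff, mem_carrier_prime_iff]

/-- **The elements of `M_J^pf_{𝔮_j}` are exactly the roots `(e_j^k)^{1/n}`.** [cite: MochizukiFrdI2008, §0 p.12] -/
theorem mem_submonoid_q_iff {j : J} {x : Perfection (Multiplicative (J → ℕ))} :
    x ∈ (q j).submonoid ↔ ∃ (k : ℕ) (n : ℕ+), x = Perfection.mk (single j k) n := by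
  constructor
  · intro hx
    induction hx using Submonoid.closure_induction with
    | mem y hy =>
      obtain ⟨⟨g, n⟩, rfl⟩ := Perfection.mk_surjective y
      dsimp only at hy ⊢
      obtain ⟨k, -, hk⟩ := mk_mem_carrier_q_iff.1 hy
      exact ⟨k, n, by rw [hk]⟩
    | one => exact ⟨0, 1, by rw [single_zero, Perfection.mk_one]⟩
    | mul y z _ _ hy hz =>
      obtain ⟨k, n, rfl⟩ := hy
      obtain ⟨k', n', rfl⟩ := hz
      exact ⟨k * n' + k' * n, n * n', by
        rw [Perfection.mk_mul_mk, single_pow, single_pow, single_mul_single]; congr 2; ring⟩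
  · rintro ⟨k, n, rfl⟩
    by_cases hk : k = 0
    · rw [hk, single_zero, Perfection.mk_one]; exact one_mem _
    · exact Submonoid.subset_closure (mk_mem_carrier_q_iff.2 ⟨k, hk, rfl⟩)

/-- `π_j^pf` fixes the elements of `M_J^pf_{𝔮_j}`. [cite: MochizukiFrdI2008, §0 p.12] -/
theorem map_proj_eq_self_of_mem {j : J} {x : Perfection (Multiplicative (J → ℕ))} (hx : x ∈ (q j).submonoid) :
    Perfection.map (proj j) x = x := by
  obtain ⟨k, n, rfl⟩ := mem_submonoid_q_iff.1 hx
  rw [Perfection.map_mk, proj_single]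

/-- `π_j^pf` takes values in `M_J^pf_{𝔮_j}`. [cite: MochizukiFrdI2008, §0 p.12] -/
theorem map_proj_mem (j : J) (x : Perfection (Multiplicative (J → ℕ))) :
    Perfection.map (proj j) x ∈ (q j).submonoid := by
  obtain ⟨⟨f, n⟩, rfl⟩ := Perfection.mk_surjective x
  exact mem_submonoid_q_iff.2 ⟨coeff f j, n, rfl⟩

/-- The `𝔮_j`-component of `x ∈ M_J^pf`: `π_j^pf(x) ∈ M_J^pf_{𝔮_j}`. [cite: MochizukiFrdI2008, Def. 2.4(i) p.47] -/
def pfAtCoord (x : Perfection (Multiplicative (J → ℕ))) (j : J) : PfAt (Multiplicative (J → ℕ)) (q j) :=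
  ⟨Perfection.map (proj j) x, map_proj_mem j x⟩

/-- `pfAtCoord` is multiplicative. [cite: MochizukiFrdI2008, Def. 2.4(i) p.47] -/
theorem pfAtCoord_mul (x y : Perfection (Multiplicative (J → ℕ))) (j : J) :
    pfAtCoord (x * y) j = pfAtCoord x j * pfAtCoord y j :=
  Subtype.ext (map_mul _ _ _)

/-- `pfAtCoord 1 = 1`. [cite: MochizukiFrdI2008, Def. 2.4(i) p.47] -/
theorem pfAtCoord_one (j : J) : pfAtCoord (1 : Perfection (Multiplicative (J → ℕ))) j = 1 :=
  Subtype.ext (map_one _)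

/-- An element of `M_J^pf_{𝔮_j}` dividing `x` in `M_J^pf` divides the `𝔮_j`-component of `x` inside
`M_J^pf_{𝔮_j}`. [cite: MochizukiFrdI2008, Def. 2.4(i) p.47] -/
theorem dvd_pfAtCoord_of_dvd {j : J} (y : PfAt (Multiplicative (J → ℕ)) (q j))
    {x : Perfection (Multiplicative (J → ℕ))} (h : (y : Perfection _) ∣ x) : y ∣ pfAtCoord x j := by
  obtain ⟨z, hz⟩ := h
  refine ⟨⟨Perfection.map (proj j) z, map_proj_mem j z⟩, Subtype.ext ?_⟩
  change Perfection.map (proj j) x = (y : Perfection _) * Perfection.map (proj j) z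
  rw [hz, map_mul, map_proj_eq_self_of_mem y.2]

/-- The `𝔮_j`-component of `x` lies below `x`. [cite: MochizukiFrdI2008, Def. 2.4(i) p.47] -/
theorem pfAtCoord_dvd (x : Perfection (Multiplicative (J → ℕ))) (j : J) : (pfAtCoord x j : Perfection _) ∣ x := by
  obtain ⟨⟨f, n⟩, rfl⟩ := Perfection.mk_surjective x
  obtain ⟨g, hg⟩ := proj_dvd j f
  refine ⟨Perfection.mk g n, ?_⟩
  change Perfection.mk f n = Perfection.map (proj j) (Perfection.mk f n) * Perfection.mk g n
  rw [Perfection.map_mk, ← mk_mul, ← hg]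

/-! ### The factorization homomorphism, computed -/

/-- `M_J^rlf_𝔮` is `ℝ`-monoprime (the realification of the monoprime `M_J^pf_𝔮`), so bounded subsets have
suprema. [cite: MochizukiFrdI2008, §0 p.12] -/
theorem isRMonoprime_rlfAt (𝔮 : Primes (Perfection (Multiplicative (J → ℕ)))) :
    IsRMonoprime (RlfAt (Multiplicative (J → ℕ)) 𝔮) :=
  isRMonoprime_realification (isMonoprime_pfAt 𝔮)

/-- `Bound_{𝔮_j ∪ {0}}(x)` is bounded by (the image of) the `𝔮_j`-component of `x` — clause (c)
"well-defined". [cite: MochizukiFrdI2008, Def. 2.4(i) p.47] -/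
theorem isBoundedBy_boundAt (x : Perfection (Multiplicative (J → ℕ))) (j : J) :
    IsBoundedBy (boundAt (Multiplicative (J → ℕ)) (q j) x) (Realification.of _ (pfAtCoord x j)) := by
  rintro _ ⟨y, -, hyx, rfl⟩
  exact map_dvd _ (dvd_pfAtCoord_of_dvd y hyx)

/-- The `𝔮_j`-component of `x` itself belongs to `Bound_{𝔮_j ∪ {0}}(x)`. [cite: MochizukiFrdI2008, Def. 2.4(i) p.47] -/
theorem of_pfAtCoord_mem_boundAt (x : Perfection (Multiplicative (J → ℕ))) (j : J) :
    Realification.of _ (pfAtCoord x j) ∈ boundAt (Multiplicative (J → ℕ)) (q j) x := by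
  refine ⟨pfAtCoord x j, ?_, pfAtCoord_dvd x j, rfl⟩
  obtain ⟨⟨f, n⟩, rfl⟩ := Perfection.mk_surjective x
  by_cases hf : coeff f j = 0
  · right
    change Perfection.map (proj j) (Perfection.mk f n) = 1
    rw [Perfection.map_mk, proj_apply, hf, single_zero, Perfection.mk_one]
  · left
    change Perfection.map (proj j) (Perfection.mk f n) ∈ (q j).carrier
    rw [Perfection.map_mk, proj_apply]
    exact mk_mem_carrier_q_iff.2 ⟨_, hf, rfl⟩

/-- **The factorization homomorphism of `∏_J ℤ≥0` at `𝔮_j` is the `j`-th coordinate**: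
`factorMap (x) 𝔮_j = π_j^pf(x) ⊗ 1` (the sup of Def. 2.4 (i)(c) is attained).
[cite: MochizukiFrdI2008, Def. 2.4(i) p.47] -/
theorem factorMap_apply (x : Perfection (Multiplicative (J → ℕ))) (j : J) :
    factorMap (Multiplicative (J → ℕ)) x (q j) = Realification.of _ (pfAtCoord x j) := by
  have hspec := divSup_spec_of_isRMonoprime (isRMonoprime_rlfAt (q j)) (isBoundedBy_boundAt x j)
  apply Realification.dvd_antisymm
  · exact (hspec _).1 (isBoundedBy_boundAt x j)
  · exact (hspec _).2 dvd_rfl _ (of_pfAtCoord_mem_boundAt x j)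

/-- Every prime of `M_J^pf` is a `𝔮_j`. [cite: MochizukiFrdI2008, §0 p.12] -/
theorem exists_eq_q (𝔮 : Primes (Perfection (Multiplicative (J → ℕ)))) : ∃ j, q j = 𝔮 := q_bijective.2 𝔮

/-- **Clause (c), "well-defined"**: every `Bound_{𝔮 ∪ {0}}(x)` is bounded. [cite: MochizukiFrdI2008, Def. 2.4(i) p.47] -/
theorem bounded (𝔮 : Primes (Perfection (Multiplicative (J → ℕ)))) (x : Perfection (Multiplicative (J → ℕ))) :
    ∃ b, IsBoundedBy (boundAt (Multiplicative (J → ℕ)) 𝔮 x) b := by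
  obtain ⟨j, rfl⟩ := exists_eq_q 𝔮
  exact ⟨_, isBoundedBy_boundAt x j⟩

/-- **Clause (c), homomorphism**: `factorMap 1 = 1`. [cite: MochizukiFrdI2008, Def. 2.4(i) p.47] -/
theorem factorMap_one : factorMap (Multiplicative (J → ℕ)) 1 = 1 := by
  funext 𝔮
  obtain ⟨j, rfl⟩ := exists_eq_q 𝔮
  rw [factorMap_apply, pfAtCoord_one, map_one, Pi.one_apply]

/-- **Clause (c), homomorphism**: `factorMap (x y) = factorMap x · factorMap y`. [cite: MochizukiFrdI2008, Def. 2.4(i) p.47] -/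
theorem factorMap_mul (x y : Perfection (Multiplicative (J → ℕ))) :
    factorMap (Multiplicative (J → ℕ)) (x * y) = factorMap _ x * factorMap _ y := by
  funext 𝔮
  obtain ⟨j, rfl⟩ := exists_eq_q 𝔮
  rw [Pi.mul_apply, factorMap_apply, factorMap_apply, factorMap_apply, pfAtCoord_mul, map_mul]

/-- Equality in `M_J^pf` is equality of all coordinates. [cite: MochizukiFrdI2008, §0 p.11] -/
theorem eq_of_forall_map_proj_eq {x y : Perfection (Multiplicative (J → ℕ))}
    (h : ∀ j, Perfection.map (proj j) x = Perfection.map (proj j) y) : x = y := by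
  obtain ⟨⟨f, n⟩, rfl⟩ := Perfection.mk_surjective x
  obtain ⟨⟨g, m⟩, rfl⟩ := Perfection.mk_surjective y
  refine Perfection.mk_eq_mk_iff.2 ⟨1, ext fun j => ?_⟩
  have hj := h j
  rw [Perfection.map_mk, Perfection.map_mk, proj_apply, proj_apply, Perfection.mk_eq_mk_iff] at hj
  obtain ⟨N, hN⟩ := hj
  have := congrArg (fun z => coeff z j) hN
  simp only [single_pow, coeff_single_same, coeff_pow, PNat.one_coe, one_mul] at this ⊢
  have hN0 : 0 < (N : ℕ) := N.pos
  exact Nat.eq_of_mul_eq_mul_left hN0 (by linarith [this])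

/-- **Clause (c), injective.** [cite: MochizukiFrdI2008, Def. 2.4(i) p.47] -/
theorem factorMap_injective : Injective (factorMap (Multiplicative (J → ℕ))) := by
  intro x y hxy
  refine eq_of_forall_map_proj_eq fun j => ?_
  have h := congrFun hxy (q j)
  rw [factorMap_apply, factorMap_apply] at h
  exact congrArg Subtype.val (Realification.of_injective (isMonoprime_pfAt (q j)) h)

/-- Transport of membership along an equality of primes. [cite: MochizukiFrdI2008, §0 p.12] -/
private theorem mem_of_eq {𝔮 : Primes (Perfection (Multiplicative (J → ℕ)))} {j : J} (h : q j = 𝔮)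
    {x : Perfection (Multiplicative (J → ℕ))} (hx : x ∈ (q j).submonoid) : x ∈ 𝔮.submonoid := h ▸ hx

/-- The `𝔮`-component of `x` for an arbitrary prime `𝔮 = 𝔮_j`. [cite: MochizukiFrdI2008, Def. 2.4(i) p.47] -/
def coordAt (x : Perfection (Multiplicative (J → ℕ))) (𝔮 : Primes (Perfection (Multiplicative (J → ℕ)))) :
    PfAt (Multiplicative (J → ℕ)) 𝔮 :=
  ⟨Perfection.map (proj (exists_eq_q 𝔮).choose) x, mem_of_eq (exists_eq_q 𝔮).choose_spec (map_proj_mem _ x)⟩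

/-- At `𝔮 = 𝔮_j`, `coordAt x 𝔮` is `pfAtCoord x j`. [cite: MochizukiFrdI2008, Def. 2.4(i) p.47] -/
theorem coordAt_q (x : Perfection (Multiplicative (J → ℕ))) (j : J) : coordAt x (q j) = pfAtCoord x j := by
  have hj : (exists_eq_q (q j)).choose = j := q_bijective.1 (exists_eq_q (q j)).choose_spec
  apply Subtype.ext
  change Perfection.map (proj (exists_eq_q (q j)).choose) x = Perfection.map (proj j) x
  rw [hj]

/-- **Clause (c), image**: `factorMap x ∈ ∏_𝔮 M^pf_𝔮`. [cite: MochizukiFrdI2008, Def. 2.4(i) p.47] -/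
theorem factorMap_mem_range (x : Perfection (Multiplicative (J → ℕ))) :
    factorMap (Multiplicative (J → ℕ)) x ∈ Set.range (pfFactorToRlfFactor (Multiplicative (J → ℕ))) := by
  refine ⟨coordAt x, funext fun 𝔮 => ?_⟩
  obtain ⟨j, rfl⟩ := exists_eq_q 𝔮
  rw [pfFactorToRlfFactor_apply, coordAt_q, factorMap_apply]

/-! ### The repaired clause (d♮) "integral patterns", and the consequences of (d) that survive -/

/-- An element of `M_J` lying (in `M_J^pf`) in `M_J^pf_{𝔮_j}` is an `e_j^k`. [cite: MochizukiFrdI2008, §0 p.12] -/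
theorem exists_eq_single_of_of_mem {j : J} {g : Multiplicative (J → ℕ)}
    (hg : Perfection.of _ g ∈ (q j).submonoid) : ∃ k, g = single j k := by
  obtain ⟨k, n, hkn⟩ := mem_submonoid_q_iff.1 hg
  rw [Perfection.of_apply, Perfection.mk_eq_mk_iff] at hkn
  obtain ⟨N, hN⟩ := hkn
  refine ⟨coeff g j, eq_single_of_coeff_eq_zero fun i hi => ?_⟩
  have := congrArg (fun z => coeff z i) hN
  simp only [coeff_pow, single_pow, coeff_single_of_ne hi] at this
  have hN0 : (N : ℕ) * (n : ℕ) ≠ 0 := (Nat.mul_pos N.pos n.pos).ne'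
  rcases Nat.mul_eq_zero.1 this with h0 | h0
  · exact absurd h0 hN0
  · exact h0

/-- **(d♮), the repaired clause of F-L2d2-1, for `∏_J ℤ≥0` in its strongest form**: EVERY family of INTEGRAL
components `(e_j^{k_j})_j ∈ ∏_𝔮 M_J^pf_𝔮` (components in the image of `M_J`) is the factorization of an
element of `M_J` — no support condition is needed. [cite: MochizukiFrdI2008, Def. 2.4(i) p.47] -/
theorem exists_factorMap_eq_of_integral (x : PfFactor (Multiplicative (J → ℕ)))
    (hx : ∀ 𝔮, (x 𝔮 : Perfection _) ∈ MonoidHom.mrange (Perfection.of (Multiplicative (J → ℕ)))) :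
    ∃ f : Multiplicative (J → ℕ),
      factorMap (Multiplicative (J → ℕ)) (Perfection.of _ f) = pfFactorToRlfFactor _ x := by
  choose g hg using hx
  have hgs : ∀ j, ∃ k, g (q j) = single j k := fun j =>
    exists_eq_single_of_of_mem ((hg (q j)).symm ▸ (x (q j)).2)
  choose k hk using hgs
  refine ⟨Multiplicative.ofAdd k, funext fun 𝔮 => ?_⟩
  obtain ⟨j, rfl⟩ := exists_eq_q 𝔮
  rw [factorMap_apply, pfFactorToRlfFactor_apply]
  congr 1
  apply Subtype.ext
  change Perfection.map (proj j) (Perfection.of _ (Multiplicative.ofAdd k)) = (x (q j) : Perfection _)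
  rw [← hg (q j), hk j, Perfection.of_apply, Perfection.map_mk, Perfection.of_apply, proj_apply]
  rfl

/-- If `(e_j^k)^{1/n} ≤ (e_j^{k'})^{1/m}` in `M_J^pf` then `k · m ≤ k' · n`. [cite: MochizukiFrdI2008, §0 p.11] -/
theorem mul_le_mul_of_mk_single_dvd {j : J} {k k' : ℕ} {n m : ℕ+}
    (h : Perfection.mk (single j k) n ∣ Perfection.mk (single j k') m) : k * (m : ℕ) ≤ k' * (n : ℕ) := by
  obtain ⟨w, hw⟩ := h
  obtain ⟨⟨g, l⟩, rfl⟩ := Perfection.mk_surjective w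
  rw [Perfection.mk_mul_mk, Perfection.mk_eq_mk_iff] at hw
  obtain ⟨N, hN⟩ := hw
  have := congrArg (fun z => coeff z j) hN
  simp only [coeff_pow, coeff_mul, single_pow, coeff_single_same, PNat.mul_coe] at this
  have hN0 : 0 < (N : ℕ) := N.pos
  have hl0 : 0 < (l : ℕ) := l.pos
  have hB : (N : ℕ) * (m : ℕ) * ((l : ℕ) * k) ≤ (N : ℕ) * ((n : ℕ) * (l : ℕ)) * k' := by
    rw [this, Nat.mul_add]
    exact Nat.le_add_right _ _
  have hB' : ((N : ℕ) * (l : ℕ)) * (k * (m : ℕ)) ≤ ((N : ℕ) * (l : ℕ)) * (k' * (n : ℕ)) :=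
    calc ((N : ℕ) * (l : ℕ)) * (k * (m : ℕ)) = (N : ℕ) * (m : ℕ) * ((l : ℕ) * k) := by ring
      _ ≤ (N : ℕ) * ((n : ℕ) * (l : ℕ)) * k' := hB
      _ = ((N : ℕ) * (l : ℕ)) * (k' * (n : ℕ)) := by ring
  exact Nat.le_of_mul_le_mul_left hB' (Nat.mul_pos hN0 hl0)

/-- **The printed bracket "[`a ≤ b` holds in `M^pf` iff it holds in `M^pf_factor`]" for `∏_J ℤ≥0`**
(the part of (d) used by [FrdI] §2–§4; clause (d_ord) of F-L2d2-1). [cite: MochizukiFrdI2008, Def. 2.4(i) p.47] -/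
theorem dvd_of_factorMap_dvd {x y : Perfection (Multiplicative (J → ℕ))}
    (h : ∀ 𝔮, factorMap (Multiplicative (J → ℕ)) x 𝔮 ∣ factorMap _ y 𝔮) : x ∣ y := by
  obtain ⟨⟨f, n⟩, rfl⟩ := Perfection.mk_surjective x
  obtain ⟨⟨g, m⟩, rfl⟩ := Perfection.mk_surjective y
  -- coordinatewise: `f_j · m ≤ g_j · n`
  have hle : ∀ j, coeff f j * (m : ℕ) ≤ coeff g j * (n : ℕ) := by
    intro j
    have hj := h (q j)
    rw [factorMap_apply, factorMap_apply] at hj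
    -- divisibility is total in the monoprime `M^pf_{𝔮_j}`; `of` is injective there
    have hdvd : pfAtCoord (Perfection.mk f n) j ∣ pfAtCoord (Perfection.mk g m) j := by
      rcases (isMonoprime_pfAt (q j)).dvd_total (pfAtCoord (Perfection.mk f n) j)
        (pfAtCoord (Perfection.mk g m) j) with h1 | h1
      · exact h1
      · have := Realification.dvd_antisymm hj (map_dvd _ h1)
        rw [Realification.of_injective (isMonoprime_pfAt (q j)) this]
    have hdvd' := map_dvd (q j).submonoid.subtype hdvd
    change Perfection.map (proj j) (Perfection.mk f n) ∣ Perfection.map (proj j) (Perfection.mk g m) at hdvd'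
    rw [Perfection.map_mk, Perfection.map_mk, proj_apply, proj_apply] at hdvd'
    exact mul_le_mul_of_mk_single_dvd hdvd'
  refine ⟨Perfection.mk (Multiplicative.ofAdd fun j => coeff g j * (n : ℕ) - coeff f j * (m : ℕ)) (n * m), ?_⟩
  rw [Perfection.mk_mul_mk, Perfection.mk_eq_mk_iff]
  refine ⟨1, ext fun j => ?_⟩
  simp only [coeff_pow, coeff_mul, PNat.mul_coe, PNat.one_coe, one_mul]
  change (n : ℕ) * ((n : ℕ) * (m : ℕ)) * coeff g j =
    (m : ℕ) * ((n : ℕ) * (m : ℕ) * coeff f j + (n : ℕ) * (coeff g j * (n : ℕ) - coeff f j * (m : ℕ)))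
  zify [hle j]
  ring

open Classical in
/-- **Restriction to a sub-support** (clause (d_res) of F-L2d2-1, what [FrdI] Prop. 4.1's splitting uses): for
every `y ∈ M_J^pf` and every set `S` of primes, the element of `M^pf_factor` equal to the factorization of
`y` on `S` and trivial off `S` is again a factorization. [cite: MochizukiFrdI2008, Def. 2.4(i) p.47] -/
theorem exists_factorMap_restrict (y : Perfection (Multiplicative (J → ℕ)))
    (S : Set (Primes (Perfection (Multiplicative (J → ℕ))))) :
    ∃ z : Perfection (Multiplicative (J → ℕ)), ∀ 𝔮,
      factorMap (Multiplicative (J → ℕ)) z 𝔮 = if 𝔮 ∈ S then factorMap _ y 𝔮 else 1 := by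
  obtain ⟨⟨g, m⟩, rfl⟩ := Perfection.mk_surjective y
  refine ⟨Perfection.mk (Multiplicative.ofAdd fun j => if q j ∈ S then coeff g j else 0) m, fun 𝔮 => ?_⟩
  obtain ⟨j, rfl⟩ := exists_eq_q 𝔮
  rw [factorMap_apply, factorMap_apply]
  split_ifs with hS
  · congr 1
    apply Subtype.ext
    change Perfection.map (proj j) _ = Perfection.map (proj j) _
    rw [Perfection.map_mk, Perfection.map_mk, proj_apply, proj_apply]
    congr 2
    change (if q j ∈ S then coeff g j else 0) = coeff g j
    rw [if_pos hS]
  · rw [← (Realification.of _).map_one]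
    congr 1
    apply Subtype.ext
    change Perfection.map (proj j) _ = 1
    rw [Perfection.map_mk, proj_apply]
    have : coeff (Multiplicative.ofAdd fun j => if q j ∈ S then coeff g j else 0) j = 0 := by
      change (if q j ∈ S then coeff g j else 0) = 0
      rw [if_neg hS]
    rw [this, single_zero, Perfection.mk_one]

end PiNat

end Literature.AlgebraicGeometry.Frobenioids

end
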